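import Literature.AnabelianGeometry.EtaleTheta.SettingModelChiTwistedLattice
import Literature.AnabelianGeometry.EtaleTheta.SettingModelChiTheta
import HarnessLib

/-!
# The χ-twisted root model with an extra Tate lattice, file 1b: the FIBRED coverings `Y□_N ⊇ Z□_N`
# (F-2633 closure certificate «F2633-SWAP-TOWER»)

Mochizuki, *The étale theta function …*, Publ. RIMS **45** (2009) [EtTh], §1, PRIMS PDF pp. 13–14, 18
[cite: MochizukiEtTh2009, §1 p.13] ("a Galois covering `Y_N → Y` … `1 → (Δ^tp_Y)^ell ⊗ ℤ/Nℤ → Gal(Y_N/Y) → Gal(K_N/K) → 1`",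
"`Z_N → Y_N` … `1 → Δ_Θ ⊗ ℤ/Nℤ → Gal(Z_N/Y_N) → Gal(J_N/K_N) → 1`", "`Y_M → Y` may be regarded as a subcovering of `Y_N → Y`").

LATTICE TWIST OF `Ẑ(1)²` — NOT the (B) section twist (cf. file 1, `SettingModelChiTwistedLattice.lean`, and
abc-iut-L2-lead R709).  abc-iut cell, K-L6 slice, row «KL6-CLOSURE-CERT F-2633», seat abc-iut-L6-t19 (gen 8).

Over the carrier `Π^tp_X := (Γ × Ẑ(1)²) ⋊_χ G_{ℚ_p}` of file 1 (`PiTpLat`, `curveLat`) this file defines the coverings WITH THE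
`Y_N`/`Z_N` INDICES CARRIED BY THE LATTICE, by name over abc-iut-L2-t1's generic `Semidirect.twistedProd` /
`Semidirect.leftHom` (`SettingModelSemidirect`), `levelHom`, `chiTwistData`, the `K_N`/`J_N` Galois lemmas
(`SettingModelGalois`, `SettingModelKrullOpenSubgroups`) and abc-iut-w5-d091's `ZHatLevel.*`:
* `degLat : Γ × Latt → ℤ` (degree through `pr₁`); `psiLat N : (γ, t) ↦ y_N(γ) + ℓ_N(t₁)` (Heisenberg `y`-coordinate of the
  level-`N` shadow plus the level of the FIRST lattice coordinate); `lattLevel₂ N : (γ, t) ↦ ℓ_N(t₂)`; both scale by `χ_N(σ)`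
  under `actLat σ` (`toAdd_psiLat_actLat`, `toAdd_lattLevel₂_actLat`);
* `AYLat N := Ker deg ⊓ Ker ψ_N ⊇ AZLat N := AYLat N ⊓ Ker ℓ_N(t₂)` — normal, open, `G_{ℚ_p}`-stable, antitone in `N`, of
  successive indices `N`, `N` IN THE LATTICE (`relIndex_AYLat`, `relIndex_AZLat`);
* **`YNLat N := AYLat N ⋊ G_{K_N}`**, **`ZNLat N := AZLat N ⋊ G_{J_N}`**, `toZLat := deg ∘ left`: every `Y_N`/`Z_N` clause of the
  root interface — NORMALITY by `Semidirect.twistedProd_normal` since `χ_N ≡ 1` on `G_{K_N}`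
  (`levelChar_chi_eq_one_of_mem_fixingSubgroup_fieldKN`), Galois images, indices, openness, monotonicity, `Y_1 = Ker toZ`.
`Π^tp_Ÿ = YNLat 2 = {deg 0, y₂ + ℓ₂(t₁) = 0} ⋊ G_{ℚ_p}` is visibly NOT stable under the swap `t₁ ↔ t₂` (used in file 3).

HONEST LABEL: semi-synthetic model (consistency/independence evidence for OUR typed interface only); not the tempered
fundamental group of a curve; nothing of [EtTh] asserted; decides (H1)/F-2633 at no genuine instance; no side taken on
[IUTchIII] Cor. 3.12.  Class (b) construction file (def-bearing; no instance, no notation, no Prop-valued def).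
-/

noncomputable section

namespace Literature.AnabelianGeometry.EtaleTheta.SettingModel

open Literature.AnabelianGeometry.SemiGraphs _root_.Topology _root_.Function

variable (p : ℕ) [Fact p.Prime]

/-! ### Levels on `Ẑ` (complements) -/

/-- A homomorphism into a discrete group with open kernel is continuous. [folklore] -/
private theorem continuous_of_isOpen_ker {A B : Type*} [Group A] [TopologicalSpace A] [IsTopologicalGroup A]
    [Group B] [TopologicalSpace B] [DiscreteTopology B] (f : A →* B) (hf : IsOpen (f.ker : Set A)) :
    Continuous f := by
  refine continuous_def.2 fun U _ => isOpen_iff_forall_mem_open.2 fun a ha => ?_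
  refine ⟨(fun x => a⁻¹ * x) ⁻¹' (f.ker : Set A), ?_, ?_, ?_⟩
  · intro x hx
    have hx' : f (a⁻¹ * x) = 1 := hx
    rw [map_mul, map_inv, inv_mul_eq_one] at hx'
    show f x ∈ U
    rw [← hx']; exact ha
  · exact hf.preimage (continuous_const.mul continuous_id)
  · show f (a⁻¹ * a) = 1
    rw [inv_mul_cancel, map_one]

/-- The level characters `Ẑ → ℤ/n` are continuous. [cite: RibesZalesskii2010, Thm 2.7.1] -/
theorem continuous_zhatLevel (n : ℕ+) : Continuous (ZHatLevel.level n : ZH → Multiplicative (ZMod n)) :=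
  continuous_of_isOpen_ker _ (ZHatLevel.isOpen_ker_level n)

/-- Compatibility of the levels `Ẑ → ℤ/N → ℤ/M` for `M ∣ N`. [cite: RibesZalesskii2010, Thm 2.7.1] -/
theorem castHom_toAdd_level_of_dvd {M N : ℕ+} (h : (M : ℕ) ∣ (N : ℕ)) (t : ZH) :
    ZMod.castHom h (ZMod M) (Multiplicative.toAdd (ZHatLevel.level N t)) = Multiplicative.toAdd (ZHatLevel.level M t) := by
  obtain ⟨k, hk⟩ := h
  have hkpos : 0 < k := Nat.pos_of_ne_zero fun h0 => by simp [h0] at hk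
  obtain rfl : N = M * ⟨k, hkpos⟩ := PNat.eq hk
  exact ZHatLevel.cast_level_mul M ⟨k, hkpos⟩ t

/-- Every class mod `n` is the level of some element of `Ẑ`. [cite: RibesZalesskii2010, Thm 2.7.1] -/
theorem exists_toAdd_level_eq (n : ℕ+) (c : ZMod n) : ∃ t : ZH, Multiplicative.toAdd (ZHatLevel.level n t) = c := by
  obtain ⟨k, hk⟩ := ZMod.intCast_surjective c
  exact ⟨ZHatLevel.eta k, by rw [ZHatLevel.level_eta, toAdd_ofAdd, hk]⟩

/-! ### The degree and the twisted levels on `Γ × Ẑ(1)²` -/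

/-- The degree `Γ × Latt → ℤ`, `(γ, t) ↦ pr₂ γ`. [cite: MochizukiEtTh2009, §1 p.12] -/
def degLat : GfpLat →* Multiplicative ℤ := gfpSnd.comp (MonoidHom.fst Gfp Latt)

/-- [cite: MochizukiEtTh2009, §1 p.12] -/
@[simp] theorem degLat_apply (x : GfpLat) : degLat x = gfpSnd x.1 := rfl

/-- The degree is invariant under the action. [cite: MochizukiEtTh2009, §1 p.12] -/
theorem degLat_actLat (σ : GQp p) (x : GfpLat) : degLat (actLat p σ x) = degLat x := gfpSnd_twistGfp (chi p σ) x.1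

/-- The degree is onto. [cite: MochizukiEtTh2009, §1 p.12] -/
theorem degLat_surjective : Surjective degLat := fun n => by
  obtain ⟨γ, hγ⟩ := gfpSnd_surjective n
  exact ⟨(γ, 1), hγ⟩

/-- `Ker(deg)` is open. [cite: MochizukiEtTh2009, §1 p.12] -/
theorem isOpen_ker_degLat : IsOpen (degLat.ker : Set GfpLat) := isOpen_ker_gfpSnd.preimage continuous_fst

/-- **`ψ_N : (γ, t) ↦ y_N(γ) + ℓ_N(t₁)`** — the level-`N` `y`-coordinate of `γ` plus the level of the first lattice
coordinate (multiplicatively). [cite: MochizukiEtTh2009, §1 p.13] -/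
def psiLat (N : ℕ+) : GfpLat →* Multiplicative (ZMod N) :=
  (Heis.yHom.comp ((levelHom N).comp (MonoidHom.fst Gfp Latt))) *
    ((ZHatLevel.level N).comp ((MonoidHom.fst ZH ZH).comp (MonoidHom.snd Gfp Latt)))

/-- [cite: MochizukiEtTh2009, §1 p.13] -/
theorem toAdd_psiLat (N : ℕ+) (x : GfpLat) : Multiplicative.toAdd (psiLat N x) =
    (levelHom N x.1).y + Multiplicative.toAdd (ZHatLevel.level N x.2.1) := rfl

/-- `ψ_N` is continuous. [cite: MochizukiEtTh2009, §1 p.13] -/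
theorem continuous_psiLat (N : ℕ+) : Continuous (psiLat N) := by
  have h1 : Continuous fun x : GfpLat => Heis.yHom (levelHom N x.1) :=
    continuous_of_discreteTopology.comp ((levelHom_continuous N).comp continuous_fst)
  have h2 : Continuous fun x : GfpLat => ZHatLevel.level N x.2.1 :=
    (continuous_zhatLevel N).comp (continuous_fst.comp continuous_snd)
  exact h1.mul h2

/-- **`ψ_N` scales by `χ_N(σ)` under the action**: `ψ_N(σ·x) = χ_N(σ)·ψ_N(x)`. [cite: MochizukiEtTh2009, §1 p.13] -/
theorem toAdd_psiLat_actLat (N : ℕ+) (σ : GQp p) (x : GfpLat) :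
    Multiplicative.toAdd (psiLat N (actLat p σ x)) = ZHatLevel.levelChar N (chi p σ) * Multiplicative.toAdd (psiLat N x) := by
  rw [toAdd_psiLat, toAdd_psiLat, actLat_apply]
  have h1 : (levelHom N (actχ p σ x.1)).y = ZHatLevel.levelChar N (chi p σ) * (levelHom N x.1).y := by
    rw [(chiTwistData p).hlev N σ x.1, chiTwistData_δ, Heis.diagTwist_apply]
  have h2 : Multiplicative.toAdd (ZHatLevel.level N (actLatt p σ x.2).1) =
      ZHatLevel.levelChar N (chi p σ) * Multiplicative.toAdd (ZHatLevel.level N x.2.1) := by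
    rw [actLatt_apply]
    exact ZHatLevel.toAdd_level_aut N (chi p σ) x.2.1
  rw [h1, h2, mul_add]

/-- The level of the SECOND lattice coordinate, `(γ, t) ↦ ℓ_N(t₂)`. [cite: MochizukiEtTh2009, §1 p.14] -/
def lattLevel₂ (N : ℕ+) : GfpLat →* Multiplicative (ZMod N) :=
  (ZHatLevel.level N).comp ((MonoidHom.snd ZH ZH).comp (MonoidHom.snd Gfp Latt))

/-- [cite: MochizukiEtTh2009, §1 p.14] -/
@[simp] theorem lattLevel₂_apply (N : ℕ+) (x : GfpLat) : lattLevel₂ N x = ZHatLevel.level N x.2.2 := rfl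

/-- `ℓ_N(t₂)` is continuous. [cite: MochizukiEtTh2009, §1 p.14] -/
theorem continuous_lattLevel₂ (N : ℕ+) : Continuous (lattLevel₂ N) :=
  (continuous_zhatLevel N).comp (continuous_snd.comp continuous_snd)

/-- `ℓ_N(t₂)` scales by `χ_N(σ)` under the action. [cite: MochizukiEtTh2009, §1 p.14] -/
theorem toAdd_lattLevel₂_actLat (N : ℕ+) (σ : GQp p) (x : GfpLat) :
    Multiplicative.toAdd (lattLevel₂ N (actLat p σ x)) =
      ZHatLevel.levelChar N (chi p σ) * Multiplicative.toAdd (lattLevel₂ N x) := by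
  rw [lattLevel₂_apply, lattLevel₂_apply, actLat_apply, actLatt_apply]
  exact ZHatLevel.toAdd_level_aut N (chi p σ) x.2.2

/-! ### The `Δ`-parts `AYLat N ⊇ AZLat N` -/

/-- `Δ□_{Y_N} := {deg = 0, ψ_N = 0} ≤ Γ × Latt`. [cite: MochizukiEtTh2009, §1 p.13] -/
def AYLat (N : ℕ+) : Subgroup GfpLat := degLat.ker ⊓ (psiLat N).ker

/-- `Δ□_{Z_N} := Δ□_{Y_N} ⊓ {ℓ_N(t₂) = 0}`. [cite: MochizukiEtTh2009, §1 p.14] -/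
def AZLat (N : ℕ+) : Subgroup GfpLat := AYLat N ⊓ (lattLevel₂ N).ker

/-- [cite: MochizukiEtTh2009, §1 p.13] -/
theorem mem_AYLat_iff (N : ℕ+) (x : GfpLat) : x ∈ AYLat N ↔ degLat x = 1 ∧ psiLat N x = 1 := by
  simp only [AYLat, Subgroup.mem_inf, MonoidHom.mem_ker]

/-- [cite: MochizukiEtTh2009, §1 p.14] -/
theorem mem_AZLat_iff (N : ℕ+) (x : GfpLat) : x ∈ AZLat N ↔ x ∈ AYLat N ∧ lattLevel₂ N x = 1 := by
  simp only [AZLat, Subgroup.mem_inf, MonoidHom.mem_ker]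

/-- [cite: MochizukiEtTh2009, §1 p.13] -/
theorem AYLat_normal (N : ℕ+) : (AYLat N).Normal := Subgroup.normal_inf_normal _ _

/-- [cite: MochizukiEtTh2009, §1 p.14] -/
theorem AZLat_normal (N : ℕ+) : (AZLat N).Normal := by
  haveI := AYLat_normal N
  exact Subgroup.normal_inf_normal _ _

/-- [cite: MochizukiEtTh2009, §1 p.14] -/
theorem AZLat_le_AYLat (N : ℕ+) : AZLat N ≤ AYLat N := inf_le_left

/-- [cite: MochizukiEtTh2009, §1 p.13] -/
theorem AYLat_le_ker_degLat (N : ℕ+) : AYLat N ≤ degLat.ker := inf_le_left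

/-- `Δ□_{Y_N}` is `G_{ℚ_p}`-stable. [cite: MochizukiEtTh2009, §1 p.13] -/
theorem actLat_mem_AYLat (N : ℕ+) (σ : GQp p) ⦃x : GfpLat⦄ (hx : x ∈ AYLat N) : actLat p σ x ∈ AYLat N := by
  rw [mem_AYLat_iff] at hx ⊢
  refine ⟨by rw [degLat_actLat]; exact hx.1, ?_⟩
  apply Multiplicative.toAdd.injective
  rw [toAdd_psiLat_actLat, hx.2, toAdd_one, mul_zero]

/-- `Δ□_{Z_N}` is `G_{ℚ_p}`-stable. [cite: MochizukiEtTh2009, §1 p.14] -/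
theorem actLat_mem_AZLat (N : ℕ+) (σ : GQp p) ⦃x : GfpLat⦄ (hx : x ∈ AZLat N) : actLat p σ x ∈ AZLat N := by
  rw [mem_AZLat_iff] at hx ⊢
  refine ⟨actLat_mem_AYLat p N σ hx.1, ?_⟩
  apply Multiplicative.toAdd.injective
  rw [toAdd_lattLevel₂_actLat, hx.2, toAdd_one, mul_zero]

/-- `Δ□_{Y_N}` is open. [cite: MochizukiEtTh2009, §1 p.13] -/
theorem isOpen_AYLat (N : ℕ+) : IsOpen (AYLat N : Set GfpLat) := by
  rw [AYLat, Subgroup.coe_inf]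
  refine isOpen_ker_degLat.inter ?_
  rw [MonoidHom.coe_ker]
  exact (isOpen_discrete _).preimage (continuous_psiLat N)

/-- `Δ□_{Z_N}` is open. [cite: MochizukiEtTh2009, §1 p.14] -/
theorem isOpen_AZLat (N : ℕ+) : IsOpen (AZLat N : Set GfpLat) := by
  rw [AZLat, Subgroup.coe_inf]
  refine (isOpen_AYLat N).inter ?_
  rw [MonoidHom.coe_ker]
  exact (isOpen_discrete _).preimage (continuous_lattLevel₂ N)

/-- `ψ_M = ψ_N mod M` for `M ∣ N`. [cite: MochizukiEtTh2009, §1 p.18] -/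
theorem castHom_toAdd_psiLat_of_dvd {M N : ℕ+} (h : (M : ℕ) ∣ (N : ℕ)) (x : GfpLat) :
    ZMod.castHom h (ZMod M) (Multiplicative.toAdd (psiLat N x)) = Multiplicative.toAdd (psiLat M x) := by
  rw [toAdd_psiLat, toAdd_psiLat, map_add, castHom_toAdd_level_of_dvd h]
  have e := map_hHat_of_dvd h (x.1 : F₂hatT × Multiplicative ℤ).1
  change Heis.map _ (levelHom N x.1) = levelHom M x.1 at e
  rw [← e, Heis.map_apply]

/-- [cite: MochizukiEtTh2009, §1 p.18] -/
theorem AYLat_anti {M N : ℕ+} (h : (M : ℕ) ∣ (N : ℕ)) : AYLat N ≤ AYLat M := by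
  intro x hx
  rw [mem_AYLat_iff] at hx ⊢
  refine ⟨hx.1, ?_⟩
  apply Multiplicative.toAdd.injective
  rw [← castHom_toAdd_psiLat_of_dvd h, hx.2, toAdd_one, map_zero, toAdd_one]

/-- [cite: MochizukiEtTh2009, §1 p.18] -/
theorem AZLat_anti {M N : ℕ+} (h : (M : ℕ) ∣ (N : ℕ)) : AZLat N ≤ AZLat M := by
  intro x hx
  rw [mem_AZLat_iff] at hx ⊢
  refine ⟨AYLat_anti h hx.1, ?_⟩
  apply Multiplicative.toAdd.injective
  rw [lattLevel₂_apply, ← castHom_toAdd_level_of_dvd h, ← lattLevel₂_apply N, hx.2, toAdd_one, map_zero, toAdd_one]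

/-- `ψ_1` is trivial: `Δ□_{Y_1} = Ker(deg)`. [cite: MochizukiEtTh2009, §1 p.14] -/
theorem AYLat_one : AYLat 1 = degLat.ker := by
  refine le_antisymm inf_le_left fun x hx => Subgroup.mem_inf.mpr ⟨hx, ?_⟩
  rw [MonoidHom.mem_ker]
  apply Multiplicative.toAdd.injective
  haveI : Subsingleton (ZMod ((1 : ℕ+) : ℕ)) := ZMod.subsingleton_iff.mpr (by simp)
  exact Subsingleton.elim _ _

/-- **`[Ker deg : Δ□_{Y_N}] = N`** — the index lives on the first lattice coordinate. [cite: MochizukiEtTh2009, §1 p.13] -/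
theorem relIndex_AYLat (N : ℕ+) : (AYLat N).relIndex degLat.ker = N := by
  rw [AYLat, inf_comm, Subgroup.inf_relIndex_right, Subgroup.relIndex_ker]
  have htop : degLat.ker.map (psiLat N) = ⊤ := by
    refine eq_top_iff.mpr fun c _ => ?_
    obtain ⟨t, ht⟩ := exists_toAdd_level_eq N (Multiplicative.toAdd c)
    refine ⟨((1 : Gfp), (t, (1 : ZH))), show degLat ((1 : Gfp), (t, (1 : ZH))) = 1 by rw [degLat_apply, map_one], ?_⟩
    apply Multiplicative.toAdd.injective
    rw [toAdd_psiLat, map_one]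
    change (1 : Heis (ZMod N)).y + Multiplicative.toAdd (ZHatLevel.level N t) = Multiplicative.toAdd c
    rw [Heis.one_y, zero_add, ht]
  rw [htop, Subgroup.card_top, Nat.card_congr Multiplicative.toAdd, Nat.card_zmod]

/-- **`[Δ□_{Y_N} : Δ□_{Z_N}] = N`** — the index lives on the second lattice coordinate. [cite: MochizukiEtTh2009, §1 p.14] -/
theorem relIndex_AZLat (N : ℕ+) : (AZLat N).relIndex (AYLat N) = N := by
  rw [AZLat, inf_comm, Subgroup.inf_relIndex_right, Subgroup.relIndex_ker]
  have htop : (AYLat N).map (lattLevel₂ N) = ⊤ := by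
    refine eq_top_iff.mpr fun c _ => ?_
    obtain ⟨t, ht⟩ := exists_toAdd_level_eq N (Multiplicative.toAdd c)
    refine ⟨((1 : Gfp), ((1 : ZH), t)), ?_, ?_⟩
    · show ((1 : Gfp), ((1 : ZH), t)) ∈ AYLat N
      rw [mem_AYLat_iff]
      refine ⟨by rw [degLat_apply, map_one], ?_⟩
      apply Multiplicative.toAdd.injective
      rw [toAdd_psiLat, map_one, toAdd_one]
      change (1 : Heis (ZMod N)).y + Multiplicative.toAdd (ZHatLevel.level N (1 : ZH)) = 0
      rw [Heis.one_y, map_one, toAdd_one, add_zero]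
    · apply Multiplicative.toAdd.injective
      rw [lattLevel₂_apply, ht]
  rw [htop, Subgroup.card_top, Nat.card_congr Multiplicative.toAdd, Nat.card_zmod]

/-! ### `Π^tp_X ↠ Z`, `Π□^tp_{Y_N}`, `Π□^tp_{Z_N}` -/

/-- **`Π^tp_X ↠ Z`** of the lattice model: `g ↦ deg(g.left)`. [cite: MochizukiEtTh2009, §1 p.12] -/
def toZLat : PiTpLat p →* Multiplicative ℤ := Semidirect.leftHom degLat (degLat_actLat p)

/-- [cite: MochizukiEtTh2009, §1 p.12] -/
theorem toZLat_apply (g : PiTpLat p) : toZLat p g = degLat g.left := rfl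

/-- [cite: MochizukiEtTh2009, §1 p.12] -/
theorem ker_toZLat : (toZLat p).ker =
    Semidirect.twistedProd degLat.ker ⊤ (Semidirect.stable_ker degLat (degLat_actLat p) ⊤) :=
  Semidirect.ker_leftHom degLat (degLat_actLat p)

/-- **`Π□^tp_{Y_N} := Δ□_{Y_N} ⋊ G_{K_N}`**. [cite: MochizukiEtTh2009, §1 p.13] -/
def YNLat (N : ℕ+) : Subgroup (PiTpLat p) :=
  Semidirect.twistedProd (AYLat N) (fieldKN ⊥ (qModel p) N).fixingSubgroup
    (Semidirect.stable_of_forall (actLat_mem_AYLat p N) _)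

/-- **`Π□^tp_{Z_N} := Δ□_{Z_N} ⋊ G_{J_N}`**. [cite: MochizukiEtTh2009, §1 p.14] -/
def ZNLat (N : ℕ+) : Subgroup (PiTpLat p) :=
  Semidirect.twistedProd (AZLat N) (fieldJN ⊥ (qModel p) N).fixingSubgroup
    (Semidirect.stable_of_forall (actLat_mem_AZLat p N) _)

/-- [cite: MochizukiEtTh2009, §1 p.13] -/
theorem mem_YNLat_iff {N : ℕ+} {g : PiTpLat p} :
    g ∈ YNLat p N ↔ g.left ∈ AYLat N ∧ g.right ∈ (fieldKN ⊥ (qModel p) N).fixingSubgroup := Iff.rfl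

/-- [cite: MochizukiEtTh2009, §1 p.14] -/
theorem mem_ZNLat_iff {N : ℕ+} {g : PiTpLat p} :
    g ∈ ZNLat p N ↔ g.left ∈ AZLat N ∧ g.right ∈ (fieldJN ⊥ (qModel p) N).fixingSubgroup := Iff.rfl

/-- **`Π□^tp_{Y_N}` is normal** (`χ_N ≡ 1` on `G_{K_N}`, so `G_{K_N}` acts trivially on `(Γ × Latt)/Δ□_{Y_N}`).
[cite: MochizukiEtTh2009, §1 p.14] -/
theorem YNLat_normal (N : ℕ+) : (YNLat p N).Normal := by
  haveI := AYLat_normal N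
  haveI := fixingSubgroup_fieldKN_bot_normal _ (qModel_mem_botχ p) N
  refine Semidirect.twistedProd_normal (actLat_mem_AYLat p N) fun b hb n => ?_
  rw [mem_AYLat_iff]
  refine ⟨by rw [map_mul, map_inv, degLat_actLat, mul_inv_cancel], ?_⟩
  apply Multiplicative.toAdd.injective
  rw [map_mul, map_inv, toAdd_mul, toAdd_inv, toAdd_psiLat_actLat,
    levelChar_chi_eq_one_of_mem_fixingSubgroup_fieldKN p ⊥ (qModel p) N hb, one_mul, add_neg_cancel, toAdd_one]

/-- **`Π□^tp_{Z_N}` is normal.** [cite: MochizukiEtTh2009, §1 p.15] -/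
theorem ZNLat_normal (N : ℕ+) : (ZNLat p N).Normal := by
  haveI := AZLat_normal N
  haveI := fixingSubgroup_fieldJN_bot_normal _ (qModel_mem_botχ p) N
  refine Semidirect.twistedProd_normal (actLat_mem_AZLat p N) fun b hb n => ?_
  have hb' : ZHatLevel.levelChar N (chi p b) = 1 := levelChar_chi_eq_one_of_mem_fixingSubgroup_fieldJN p ⊥ (qModel p) N hb
  rw [mem_AZLat_iff, mem_AYLat_iff]
  refine ⟨⟨by rw [map_mul, map_inv, degLat_actLat, mul_inv_cancel], ?_⟩, ?_⟩
  · apply Multiplicative.toAdd.injective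
    rw [map_mul, map_inv, toAdd_mul, toAdd_inv, toAdd_psiLat_actLat, hb', one_mul, add_neg_cancel, toAdd_one]
  · apply Multiplicative.toAdd.injective
    rw [map_mul, map_inv, toAdd_mul, toAdd_inv, toAdd_lattLevel₂_actLat, hb', one_mul, add_neg_cancel, toAdd_one]

/-- `Π□^tp_{Y_1} = Π^tp_Y = Ker(Π^tp_X ↠ Z)`. [cite: MochizukiEtTh2009, §1 p.14] -/
theorem YNLat_one : YNLat p 1 = (toZLat p).ker := by
  rw [ker_toZLat]
  exact Semidirect.twistedProd_eq_of_eq AYLat_one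
    (by rw [fieldKN_bot_one _ (qModel_mem_botχ p), IntermediateField.fixingSubgroup_bot])

/-- [cite: MochizukiEtTh2009, §1 p.13] -/
theorem YNLat_le (N : ℕ+) : YNLat p N ≤ (toZLat p).ker := by
  rw [ker_toZLat]
  exact Semidirect.twistedProd_mono (AYLat_le_ker_degLat N) le_top

/-- [cite: MochizukiEtTh2009, §1 p.14] -/
theorem ZNLat_le_YNLat (N : ℕ+) : ZNLat p N ≤ YNLat p N :=
  Semidirect.twistedProd_mono (AZLat_le_AYLat N)
    (IntermediateField.fixingSubgroup_antitone (fieldKN_le_fieldJN _ ⊥ N))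

/-- [cite: MochizukiEtTh2009, §1 p.18] -/
theorem YNLat_anti {M N : ℕ+} (h : (M : ℕ) ∣ N) : YNLat p N ≤ YNLat p M :=
  Semidirect.twistedProd_mono (AYLat_anti h)
    (IntermediateField.fixingSubgroup_antitone (fieldKN_bot_mono _ (qModel_ne_zeroχ p) h))

/-- [cite: MochizukiEtTh2009, §1 p.18] -/
theorem ZNLat_anti {M N : ℕ+} (h : (M : ℕ) ∣ N) : ZNLat p N ≤ ZNLat p M :=
  Semidirect.twistedProd_mono (AZLat_anti h)
    (IntermediateField.fixingSubgroup_antitone (fieldJN_bot_mono _ (qModel_ne_zeroχ p) h))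

/-- `Π□^tp_{Y_N} ↠ G_{K_N}`. [cite: MochizukiEtTh2009, §1 p.13] -/
theorem map_rightHom_YNLat (N : ℕ+) :
    (YNLat p N).map SemidirectProduct.rightHom = (fieldKN ⊥ (qModel p) N).fixingSubgroup :=
  Semidirect.map_rightHom_twistedProd

/-- `Π□^tp_{Z_N} ↠ G_{J_N}`. [cite: MochizukiEtTh2009, §1 p.14] -/
theorem map_rightHom_ZNLat (N : ℕ+) :
    (ZNLat p N).map SemidirectProduct.rightHom = (fieldJN ⊥ (qModel p) N).fixingSubgroup :=
  Semidirect.map_rightHom_twistedProd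

/-- `[Δ^tp_Y : Δ□^tp_{Y_N}] = N`. [cite: MochizukiEtTh2009, §1 p.13] -/
theorem relIndex_YNLat (N : ℕ+) :
    (YNLat p N ⊓ SemidirectProduct.rightHom.ker).relIndex ((toZLat p).ker ⊓ SemidirectProduct.rightHom.ker) = N := by
  rw [YNLat, ker_toZLat, Semidirect.twistedProd_inf_ker_rightHom, Semidirect.twistedProd_inf_ker_rightHom,
    Semidirect.relIndex_twistedProd_bot]
  exact relIndex_AYLat N

/-- `[Δ□^tp_{Y_N} : Δ□^tp_{Z_N}] = N`. [cite: MochizukiEtTh2009, §1 p.14] -/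
theorem relIndex_ZNLat (N : ℕ+) :
    (ZNLat p N ⊓ SemidirectProduct.rightHom.ker).relIndex (YNLat p N ⊓ SemidirectProduct.rightHom.ker) = N := by
  rw [ZNLat, YNLat, Semidirect.twistedProd_inf_ker_rightHom, Semidirect.twistedProd_inf_ker_rightHom,
    Semidirect.relIndex_twistedProd_bot]
  exact relIndex_AZLat N

/-- `Π□^tp_{Y_N}` is open. [cite: MochizukiEtTh2009, §1 p.13] -/
theorem isOpen_YNLat (N : ℕ+) : IsOpen (YNLat p N : Set (PiTpLat p)) :=
  Semidirect.isOpen_twistedProd (isInducing_leftRightLat p).continuous (isOpen_AYLat N)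
    (isOpen_fixingSubgroup_fieldKN ⊥ (qModel p) N)

/-- `Π□^tp_{Z_N}` is open. [cite: MochizukiEtTh2009, §1 p.14] -/
theorem isOpen_ZNLat (N : ℕ+) : IsOpen (ZNLat p N : Set (PiTpLat p)) :=
  Semidirect.isOpen_twistedProd (isInducing_leftRightLat p).continuous (isOpen_AZLat N)
    (isOpen_fixingSubgroup_fieldJN ⊥ (qModel p) N)

/-- `Ker(Π^tp_X ↠ Z)` is open. [cite: MochizukiEtTh2009, §1 p.12] -/
theorem isOpen_ker_toZLat : IsOpen ((toZLat p).ker : Set (PiTpLat p)) := by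
  rw [ker_toZLat]
  exact Semidirect.isOpen_twistedProd (isInducing_leftRightLat p).continuous isOpen_ker_degLat isOpen_univ

end Literature.AnabelianGeometry.EtaleTheta.SettingModel

end
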